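import Summits.ResolutionOfSingularities.ResolutionOfSingularities.Theorems.PAlterationPialtFrobeniusFFinite
import Summits.ResolutionOfSingularities.ResolutionOfSingularities.Theorems.PAlterationPicoverLocalModelOfPicover
import HarnessLib

/-!
# `Pialt` (crux stmt-ResolutionOfSingularities-0555) holds at Temkin's local models over F-finite fields

Companion to `PAlterationPialtFrobeniusFFinite.lean` (landed `--supports stmt-ResolutionOfSingularities-0555`;
does not close the item). The route's crux `PicoverLocalModel` (stmt-0557) asks for a RESOLUTION
of Temkin's local model `X_a = Spec ((R[T]/(T^p - a))_red)` over a regular finitely generated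
`k`-domain `R` (the `α_p`-torsor hypersurface `t^p = a`; Temkin 2013, Rem. 1.3.5(ii)–(iii): "the
inseparable case, where all bad things can happen"), open from `dim R = 4`. For the crux `Pialt`
nothing is open there as soon as the ground field is F-finite: `X_a → Spec R` is finite,
universally injective and surjective (`isFinite_localModel`, `universallyInjective_localModel`,
`surjective_localModel`, file `PAlterationPicoverLocalModelOfPicover`) onto the regular
`Spec R`, so the Frobenius ascent (`pialtConclusion_of_picoverShape_of_frobenius_finiteType`)
gives a purely inseparable regular alteration of `X_a` — in every dimension:

* `pialtConclusion_localModel_of_frobenius_finiteType` — over every field `k` of characteristic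
  `p` with Frobenius of finite type (`[k : k^p] < ∞`);
* `pialtConclusion_localModel_perfectField` — in particular over every perfect field.

Sources: M. Temkin, J. Algebra 373 (2013), Rem. 1.3.5(i)–(iii).
-/

noncomputable section

set_option linter.dupNamespace false -- mandated namespace of this single-conjunct summit

namespace Summit.ResolutionOfSingularities.ResolutionOfSingularities.Theorems

open Polynomial CategoryTheory AlgebraicGeometry TopologicalSpace
open Literature.AlgebraicGeometry.Resolution

/-- **`Pialt` at Temkin's local model, F-finite ground field.** For a prime `p`, a field `k` of
characteristic `p` whose Frobenius is of finite type, a regular finitely generated `k`-domain `R`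
and `a ∈ R`, the integral affine scheme `X_a = Spec ((R[T]/(T^p - a))_red)` admits a proper
surjective `g : X' → X_a` with `X'` integral regular, finite and universally injective over a
dense open: `X_a → Spec R` is a finite radicial surjective cover of the regular `Spec R`, and the
conclusion of `Pialt` ascends along it (`pialtConclusion_of_picoverShape_of_frobenius_finiteType`;
concretely `X' ≅ Spec R` mapping to `X_a` through a Frobenius power). No restriction on `dim R`.
[cite: Temkin2013, Rem. 1.3.5(i)–(iii)] -/
theorem pialtConclusion_localModel_of_frobenius_finiteType (p : ℕ) [Fact p.Prime] (k : Type)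
    [Field k] [CharP k p] (hK : (frobenius k p).FiniteType) (R : Type) [CommRing R] [IsDomain R]
    [Algebra k R] (hft : Algebra.FiniteType k R) (hreg : IsRegularRing R) (a : R) :
    ∃ (X' : Scheme.{0}) (g : X' ⟶ Spec (.of (AdjoinRoot (X ^ p - C a) ⧸
        nilradical (AdjoinRoot (X ^ p - C a))))),
      IsProper g ∧ IsIntegral X' ∧ Scheme.IsRegular X' ∧ Function.Surjective g.base ∧
        ∃ U : (Spec (.of (AdjoinRoot (X ^ p - C a) ⧸ nilradical (AdjoinRoot (X ^ p - C a))))).Opens,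
          Dense (U : Set ↥(Spec (.of (AdjoinRoot (X ^ p - C a) ⧸
            nilradical (AdjoinRoot (X ^ p - C a)))))) ∧
            IsFinite (g ∣_ U) ∧ UniversallyInjective (g ∣_ U) := by
  haveI : CharP R p := charP_of_algebra_field k R
  haveI := isDomain_adjoinRoot_X_pow_sub_C_quotient_nilradical (p := p) a
  haveI : IsRegularRing (CommRingCat.of R) := hreg
  let f : Spec (.of R) ⟶ Spec (.of k) := Spec.map (CommRingCat.ofHom (algebraMap k R))
  haveI : LocallyOfFiniteType f :=
    (HasRingHomProperty.Spec_iff (P := @LocallyOfFiniteType)).mpr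
      (RingHom.finiteType_algebraMap.mpr hft)
  haveI := isFinite_localModel (p := p) a
  haveI := universallyInjective_localModel (p := p) a
  exact pialtConclusion_of_picoverShape_of_frobenius_finiteType p k hK (Spec (.of R))
    (Spec (.of (AdjoinRoot (X ^ p - C a) ⧸ nilradical (AdjoinRoot (X ^ p - C a))))) f
    (Spec.map (CommRingCat.ofHom (algebraMap R _))) (Scheme.isRegular_Spec (.of R))
    (surjective_localModel a)

/-- **`Pialt` at Temkin's local model over a perfect field** (special case: a perfect field has
surjective, hence finite-type, Frobenius). [cite: Temkin2013, Rem. 1.3.5(i)–(iii)] -/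
theorem pialtConclusion_localModel_perfectField (p : ℕ) [Fact p.Prime] (k : Type) [Field k]
    [CharP k p] [PerfectField k] (R : Type) [CommRing R] [IsDomain R] [Algebra k R]
    (hft : Algebra.FiniteType k R) (hreg : IsRegularRing R) (a : R) :
    ∃ (X' : Scheme.{0}) (g : X' ⟶ Spec (.of (AdjoinRoot (X ^ p - C a) ⧸
        nilradical (AdjoinRoot (X ^ p - C a))))),
      IsProper g ∧ IsIntegral X' ∧ Scheme.IsRegular X' ∧ Function.Surjective g.base ∧
        ∃ U : (Spec (.of (AdjoinRoot (X ^ p - C a) ⧸ nilradical (AdjoinRoot (X ^ p - C a))))).Opens,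
          Dense (U : Set ↥(Spec (.of (AdjoinRoot (X ^ p - C a) ⧸
            nilradical (AdjoinRoot (X ^ p - C a)))))) ∧
            IsFinite (g ∣_ U) ∧ UniversallyInjective (g ∣_ U) :=
  pialtConclusion_localModel_of_frobenius_finiteType p k (frobenius_finiteType_of_perfectField p)
    R hft hreg a

end Summit.ResolutionOfSingularities.ResolutionOfSingularities.Theorems

end
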